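import Summits.QuantumAdvantage.QuantumAdvantage.Theorems.WalkTwoStepDensePeelCylinder
import Summits.QuantumAdvantage.AdviceFreeQNC0.WindowCharacters

/-!
# Rung (G♯₂) `ThreeStepFreeRungFive` (item stmt-QuantumAdvantage-23286), architecture (U), 2/3: PREFIX-COUNT RESIDUE CYLINDERS ARE LARGE

Cell qa-qnc0, route OddPrimeWalk, support item stmt-QuantumAdvantage-23286; prover qn-prover-3 g16.  Generic counting, no strategy in
sight: prescribing the residues `N(q) mod m` (`m ≥ 1`) of the prefix counts of `u ∈ {0,1}ⁿ` at the positions of a finite set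
`Q ⊆ [0, n]`, with values realised by some input `u₀`, leaves at least `2ⁿ · 2^{−(m−1)·#Q}` inputs (`card_profile_ge`).  Proof:
insert the positions in increasing order (`Finset.induction_on_max`); the new constraint at `q` is a BLOCK EVENT on the last
`min(m − 1, gap)` bits before `q`, reachable from every entry weight, so the sequential cylinder count `DensePeel.cylinder_step`
(1/5 of the `DensePinned` proof) charges a factor `2^{−(m−1)}` per position (`cyl_insert_card`; `wtPrefix_add_eq`, `exists_block_wt`).
Used by `WalkThreeStepUsableBound` (3/3) with `m = 3p` and `Q` = the residue profile of a position.
WHAT THIS IS NOT: no game content; separation NOT moved.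
-/

namespace Summit.QuantumAdvantage.AdviceFreeQNC0.LocalEngine

open Finset Classical

namespace RungU

section Cylinders

variable {n : ℕ}

/-- `N(A + ℓ) = N(A) + |block bits|` for a block inside `[0, n)`. -/
theorem wtPrefix_add_eq (u : Fin n → Bool) (A ℓ : ℕ) (hA : A + ℓ ≤ n) :
    wtPrefix u (A + ℓ) = wtPrefix u A + wt (DensePeel.blockBits u A ℓ) := by
  rw [wtPrefix_eq_add_midCount u (Nat.le_add_right A ℓ)]
  congr 1
  unfold wt
  apply Finset.card_bij (fun (i : Fin n) hi => (⟨i.val - A, by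
      have h' := (Finset.mem_filter.mp hi).2; omega⟩ : Fin ℓ))
  · intro i hi
    simp only [Finset.mem_filter, Finset.mem_univ, true_and] at hi ⊢
    unfold DensePeel.blockBits
    simp only
    rw [dif_pos (by omega)]
    have e : (⟨A + (i.val - A), by omega⟩ : Fin n) = i := by apply Fin.ext; simp only; omega
    rw [e]
    exact hi.2.2
  · intro i hi j hj hij
    simp only [Finset.mem_filter, Finset.mem_univ, true_and] at hi hj
    have := congrArg Fin.val hij
    simp only at this
    apply Fin.ext
    omega
  · intro j hj
    simp only [Finset.mem_filter, Finset.mem_univ, true_and] at hj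
    have hjn : A + j.val < n := by omega
    refine ⟨⟨A + j.val, hjn⟩, ?_, ?_⟩
    · simp only [Finset.mem_filter, Finset.mem_univ, true_and]
      refine ⟨by omega, by omega, ?_⟩
      unfold DensePeel.blockBits at hj
      rw [dif_pos hjn] at hj
      exact hj
    · apply Fin.ext
      simp only
      omega

/-- a block of `ℓ` bits with exactly `k ≤ ℓ` ones. -/
theorem exists_block_wt (ℓ k : ℕ) (hk : k ≤ ℓ) : ∃ b : Fin ℓ → Bool, wt b = k := by
  refine ⟨fun j => decide (j.val < k), ?_⟩
  unfold wt
  have e : ((univ : Finset (Fin ℓ)).filter fun j : Fin ℓ => decide (j.val < k) = true)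
      = univ.filter fun j : Fin ℓ => j.val < k := by
    apply Finset.filter_congr
    intro j _
    simp
  rw [e]
  have himg : (((univ : Finset (Fin ℓ)).filter fun j : Fin ℓ => j.val < k).image Fin.val) = Finset.range k := by
    ext i
    simp only [Finset.mem_image, Finset.mem_filter, Finset.mem_univ, true_and, Finset.mem_range]
    exact ⟨fun ⟨j, hj, e⟩ => e ▸ hj, fun hi => ⟨⟨i, lt_of_lt_of_le hi hk⟩, hi, rfl⟩⟩
  rw [← Finset.card_image_of_injective _ Fin.val_injective, himg, Finset.card_range]

/-- One cylinder step: adding the residue constraint at a new position `q = A + ℓ` beyond all of `Q` costs a factor `2^{-ℓ}`,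
given a block event `Gk` on `[A, q)` reachable from every entry weight that forces the new constraint. -/
theorem cyl_insert_card (m : ℕ) (u₀ : Fin n → Bool) (Q : Finset ℕ) (q A ℓ : ℕ) (hAq : A + ℓ = q) (hqn : q ≤ n)
    (hQA : ∀ x ∈ Q, x ≤ A) (Gk : ℕ → (Fin ℓ → Bool) → Prop) (hGk : ∀ z, ∃ b, Gk z b)
    (hstep : ∀ u : Fin n → Bool, (∀ x ∈ Q, wtPrefix u x % m = wtPrefix u₀ x % m) →
        Gk (wtPrefix u A) (DensePeel.blockBits u A ℓ) → wtPrefix u q % m = wtPrefix u₀ q % m) :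
    (1 / 2 : ℝ) ^ ℓ * ((univ.filter fun u : Fin n → Bool => ∀ x ∈ Q, wtPrefix u x % m = wtPrefix u₀ x % m).card : ℝ)
      ≤ ((univ.filter fun u : Fin n → Bool => ∀ x ∈ insert q Q, wtPrefix u x % m = wtPrefix u₀ x % m).card : ℝ) := by
  have hR : ∀ (u : Fin n → Bool) (b : Fin ℓ → Bool),
      (∀ x ∈ Q, wtPrefix (DensePeel.overwrite u A b) x % m = wtPrefix u₀ x % m) ↔
        (∀ x ∈ Q, wtPrefix u x % m = wtPrefix u₀ x % m) := by
    intro u b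
    constructor <;> intro h x hx
    · have := h x hx
      rwa [DensePeel.wtPrefix_overwrite_of_le u A b (hQA x hx)] at this
    · rw [DensePeel.wtPrefix_overwrite_of_le u A b (hQA x hx)]
      exact h x hx
  have hcs := DensePeel.cylinder_step A (by omega : A + ℓ ≤ n) Gk hGk
    (fun u : Fin n → Bool => ∀ x ∈ Q, wtPrefix u x % m = wtPrefix u₀ x % m) hR
  have hsplit := Finset.card_filter_add_card_filter_not
    (s := (univ : Finset (Fin n → Bool)).filter fun u : Fin n → Bool => ∀ x ∈ Q, wtPrefix u x % m = wtPrefix u₀ x % m)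
    (fun u => Gk (wtPrefix u A) (DensePeel.blockBits u A ℓ))
  rw [Finset.filter_filter, Finset.filter_filter] at hsplit
  have hsub : ((univ : Finset (Fin n → Bool)).filter fun u : Fin n → Bool =>
        (∀ x ∈ Q, wtPrefix u x % m = wtPrefix u₀ x % m) ∧ Gk (wtPrefix u A) (DensePeel.blockBits u A ℓ))
      ⊆ univ.filter fun u : Fin n → Bool => ∀ x ∈ insert q Q, wtPrefix u x % m = wtPrefix u₀ x % m := by
    intro u hu
    rw [Finset.mem_filter] at hu ⊢
    refine ⟨hu.1, fun x hx => ?_⟩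
    rw [Finset.mem_insert] at hx
    rcases hx with rfl | hx
    · exact hstep u hu.2.1 hu.2.2
    · exact hu.2.1 x hx
  have h1 : (((univ : Finset (Fin n → Bool)).filter fun u : Fin n → Bool =>
        (∀ x ∈ Q, wtPrefix u x % m = wtPrefix u₀ x % m) ∧ Gk (wtPrefix u A) (DensePeel.blockBits u A ℓ)).card : ℝ)
      ≤ ((univ.filter fun u : Fin n → Bool => ∀ x ∈ insert q Q, wtPrefix u x % m = wtPrefix u₀ x % m).card : ℝ) := by
    exact_mod_cast Finset.card_le_card hsub
  have h2 : (((univ : Finset (Fin n → Bool)).filter fun u : Fin n → Bool =>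
        (∀ x ∈ Q, wtPrefix u x % m = wtPrefix u₀ x % m) ∧ Gk (wtPrefix u A) (DensePeel.blockBits u A ℓ)).card : ℝ)
      + (((univ : Finset (Fin n → Bool)).filter fun u : Fin n → Bool =>
        (∀ x ∈ Q, wtPrefix u x % m = wtPrefix u₀ x % m) ∧ ¬ Gk (wtPrefix u A) (DensePeel.blockBits u A ℓ)).card : ℝ)
      = ((univ.filter fun u : Fin n → Bool => ∀ x ∈ Q, wtPrefix u x % m = wtPrefix u₀ x % m).card : ℝ) := by
    exact_mod_cast hsplit
  nlinarith [hcs, h1, h2]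

/-- **Residue cylinders are large**: prescribing `N(q) mod m` (`m ≥ 1`) at the positions `q ∈ Q ⊆ [0, n]` as realised by `u₀`
leaves at least `2ⁿ · 2^{−(m−1)·#Q}` inputs. -/
theorem card_profile_ge (m : ℕ) (hm : 1 ≤ m) (u₀ : Fin n → Bool) (Q : Finset ℕ) (hQ : ∀ q ∈ Q, q ≤ n) :
    (2 : ℝ) ^ n * ((1 / 2 : ℝ) ^ (m - 1)) ^ Q.card
      ≤ ((univ.filter fun u : Fin n → Bool => ∀ q ∈ Q, wtPrefix u q % m = wtPrefix u₀ q % m).card : ℝ) := by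
  induction Q using Finset.induction_on_max with
  | empty =>
    have e : (univ.filter fun u : Fin n → Bool => ∀ q ∈ (∅ : Finset ℕ), wtPrefix u q % m = wtPrefix u₀ q % m) = univ :=
      Finset.filter_true_of_mem fun u _ q hq => absurd hq (Finset.notMem_empty q)
    rw [e, Finset.card_empty, pow_zero, mul_one, Finset.card_univ, Fintype.card_fun, Fintype.card_bool, Fintype.card_fin]
    push_cast
    exact le_refl _
  | insert q Q hlt ih =>
    have hqn : q ≤ n := hQ q (Finset.mem_insert_self q Q)
    have hQ' : ∀ x ∈ Q, x ≤ n := fun x hx => hQ x (Finset.mem_insert_of_mem hx)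
    have ih' := ih hQ'
    have hqQ : q ∉ Q := fun h => lt_irrefl q (hlt q h)
    rw [Finset.card_insert_of_notMem hqQ, pow_succ, ← mul_assoc]
    have hhalf : (0 : ℝ) ≤ (1 / 2 : ℝ) := by norm_num
    -- the top of `Q` (0 if empty)
    have hsup : ∀ x ∈ Q, x ≤ Q.sup id := fun x hx => Finset.le_sup (f := id) hx
    by_cases hcase : q ≤ Q.sup id + (m - 1)
    · -- short gap: block `[sup Q, q)`, conditional event
      set A := Q.sup id with hA
      have hAq : A ≤ q := by
        rcases Q.eq_empty_or_nonempty with hQe | hQne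
        · rw [hA, hQe, Finset.sup_empty]; exact bot_le
        · obtain ⟨x, hx, hxe⟩ := Finset.exists_mem_eq_sup Q hQne id
          rw [hA, hxe]; exact (hlt x hx).le
      have hresA : ∀ u : Fin n → Bool, (∀ x ∈ Q, wtPrefix u x % m = wtPrefix u₀ x % m) →
          wtPrefix u A % m = wtPrefix u₀ A % m := by
        intro u hu
        rcases Q.eq_empty_or_nonempty with hQe | hQne
        · have hA0 : A = 0 := by rw [hA, hQe, Finset.sup_empty]; rfl
          rw [hA0, wtPrefix_zero, wtPrefix_zero]
        · obtain ⟨x, hx, hxe⟩ := Finset.exists_mem_eq_sup Q hQne id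
          rw [hA, hxe]; exact hu x hx
      have key := cyl_insert_card m u₀ Q q A (q - A) (by omega) hqn hsup
        (fun z b => z % m = wtPrefix u₀ A % m → (z + wt b) % m = wtPrefix u₀ q % m)
        (by
          intro z
          by_cases hz : z % m = wtPrefix u₀ A % m
          · refine ⟨DensePeel.blockBits u₀ A (q - A), fun _ => ?_⟩
            have e := wtPrefix_add_eq u₀ A (q - A) (by omega)
            rw [show A + (q - A) = q by omega] at e
            rw [e, Nat.add_mod, hz, ← Nat.add_mod]
          · exact ⟨fun _ => false, fun h => absurd h hz⟩)
        (by
          intro u hu hG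
          have e := wtPrefix_add_eq u A (q - A) (by omega)
          rw [show A + (q - A) = q by omega] at e
          rw [e]
          exact hG (hresA u hu))
      have hpow : (1 / 2 : ℝ) ^ (m - 1) ≤ (1 / 2 : ℝ) ^ (q - A) :=
        pow_le_pow_of_le_one hhalf (by norm_num) (by omega)
      calc (2 : ℝ) ^ n * ((1 / 2 : ℝ) ^ (m - 1)) ^ Q.card * (1 / 2 : ℝ) ^ (m - 1)
          ≤ ((univ.filter fun u : Fin n → Bool => ∀ q ∈ Q, wtPrefix u q % m = wtPrefix u₀ q % m).card : ℝ)
              * (1 / 2 : ℝ) ^ (q - A) := mul_le_mul ih' hpow (pow_nonneg hhalf _) (Nat.cast_nonneg _)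
        _ ≤ _ := by rw [mul_comm]; exact key
    · -- long gap: block of the last `m − 1` bits before `q`, unconditional event
      push Not at hcase
      set A := q - (m - 1) with hA
      have hQA : ∀ x ∈ Q, x ≤ A := fun x hx => by have := hsup x hx; omega
      have key := cyl_insert_card m u₀ Q q A (m - 1) (by omega) hqn hQA
        (fun z b => (z + wt b) % m = wtPrefix u₀ q % m)
        (by
          intro z
          have h0m : 0 < m := hm
          obtain ⟨b, hb⟩ := exists_block_wt (m - 1) ((wtPrefix u₀ q % m + m - z % m) % m)
            (by have := Nat.mod_lt (wtPrefix u₀ q % m + m - z % m) h0m; omega)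
          refine ⟨b, ?_⟩
          rw [hb]
          have hz : z % m < m := Nat.mod_lt _ h0m
          have ht : wtPrefix u₀ q % m < m := Nat.mod_lt _ h0m
          have h1 : Nat.ModEq m z (z % m) := (Nat.mod_modEq z m).symm
          have h2 : Nat.ModEq m ((wtPrefix u₀ q % m + m - z % m) % m) (wtPrefix u₀ q % m + m - z % m) :=
            Nat.mod_modEq _ _
          have h3 := h1.add h2
          have e : z % m + (wtPrefix u₀ q % m + m - z % m) = wtPrefix u₀ q % m + m := by omega
          rw [e] at h3
          rw [h3, Nat.add_mod_right, Nat.mod_eq_of_lt ht])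
        (by
          intro u _ hG
          have e := wtPrefix_add_eq u A (m - 1) (by omega)
          rw [show A + (m - 1) = q by omega] at e
          rw [e]
          exact hG)
      calc (2 : ℝ) ^ n * ((1 / 2 : ℝ) ^ (m - 1)) ^ Q.card * (1 / 2 : ℝ) ^ (m - 1)
          ≤ ((univ.filter fun u : Fin n → Bool => ∀ q ∈ Q, wtPrefix u q % m = wtPrefix u₀ q % m).card : ℝ)
              * (1 / 2 : ℝ) ^ (m - 1) := mul_le_mul_of_nonneg_right ih' (pow_nonneg hhalf _)
        _ ≤ _ := by rw [mul_comm]; exact key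

end Cylinders

end RungU

end Summit.QuantumAdvantage.AdviceFreeQNC0.LocalEngine
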